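import Summits.QuantumFields.YangMills.Theorems.UnitScaleTiltProp7SectET3N06LeavesRecordCut
import Summits.QuantumFields.YangMills.Theorems.UnitScaleTiltProp7SectET3G0LayerFromThm310
import Literature.MathematicalPhysics.QuantumFieldTheory.Balaban1983to89.B9Thm313WholeLettersCutKept
import Literature.MathematicalPhysics.QuantumFieldTheory.Balaban1983to89.B9Thm313WholeCutLettersL2From3152
import HarnessLib

/-!
# Route `UnitScaleTilt`, crux «MinimiserStabilityRegPr» (stmt-QuantumFields-19200, stub EX, route (α), node N06(d = 3)) — **THE RE-CUT T³ LEAF WITH THE BLOCK-L² RECORD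
# DISPLAYED BY ITS KEPT FIELDS**: the twin of ✓`Prop7SectET3N06LeavesRecordCut.t313_of_pins_T3_completePairMBZc` in which the two re-cut block-L² letters `Letters313L2Pc.vDRDG`
# (D·R·D\*·G₁) and `.vGDRD` (G₁·D·R·D\*) are NO LONGER DISPLAYED but DERIVED — Track A's `B9Thm313WholeCutLettersL2From3152.vDRDG_of_ids3152 ∕ vGDRD_of_ids3152` — from the
# displayed identity (3.152), Theorem 3.1 (3.42) for G′, (3.49) for P, (3.46)₄ for G′ and R = ϱ(I − P); the record enters as dag-n06-d g12's kept sub-record `Letters313L2Pk`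

Cell `ym-inputs` (D-0154 (2); HOME `pub/ym-inputs/`), seat ym-inputs-p04 gen 4 — item K2 of gen 3's HANDOFF («T³ consumer of dag-n06-l's second cut»), unblocked by
✓ p637771 `B9Thm313WholeLettersCutKept` (2026-08-28T13:37Z).  Count-neutral helper (`--supports stmt-QuantumFields-20520 --as helper`); registry untouched; THEOREMS ONLY
(0 `def`, 0 `sorry`); NOTHING of [Balaban1985BackgroundPropagators] is asserted.  The T³ twin of the d = 4 certificate's edition 39 recipe (dag-n06-d g12, pub-ymgap
INBOX 2026-08-28T13:37:41Z: «`hLL2 : Letters313L2Pk … ∧ Letters313L2MZ …`, `vDRDG ∕ vGDRD` DERIVED»).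

WHAT.  ★★★ `t313_of_pins_T3_completePairMBZk` — the statement of ✓`t313_of_pins_T3_completePairMBZc` with EXACTLY these changes (everything else VERBATIM, and the parent is
CALLED BY NAME, untouched — additive twin):
* `hLL2` is valued in `Letters313L2Pk (𝔬 i) (Dd i) (Dds i) 1 (H₀ i) B₄ δ₃ (vZ i) (hvZ i) U ∧ Letters313L2MZ …` — the KEPT printed block-L² letters `gDv dGDv gQs ddGQs dGQs rgdI
  rgdDs c1 q` ((3.46)-type lines), WITHOUT `vDRDG ∕ vGDRD`;
* NEW free data: `Pp : ∀ i, Cfg → End (W i → ℝ)` (print's P of (3.49), R = ϱ(I − P)), reals `ϱ CP BD BG δG` with `0 ≤ ϱ`, `0 ≤ CP`, `0 ≤ BD`, `0 ≤ BG` and ONE rate gap `hδ₃G : δ₃ < δG`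
  (the G′∕P material is read at a rate strictly above the letters' rate δ₃ — the room for [4] Lemma 2.1's two (2.60) shifts and one row-sum margin);
* NEW displayed rows under the same regularity prefix `M₁ ≤ M → … Reg335 → Reg336 →`: `h31` — `Thm31GpMaj (𝔬 i).blkW (𝔬 i).blk (Gp i U) ((𝔬 i).Dv U) ((𝔬 i).Dvstar U) 1 (H₀ i)
  BG δG` (Theorem 3.1 (3.42)₁₂₃ FOR THE SITE PROPAGATOR G′, p. 397; its own constant `BG`, since the knits DERIVE G₀'s `B₀`); `h49` — `Proj349Maj … (Pp i U) … CP δG` ((3.49) p. 399); `hDGD` —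
  `BlockBd (𝔬 i).blk (𝔬 i).blk (Dv∘G′∘Dvstar) (BD·e^{−δG d})` ((3.46)₄ for G′, p. 398); `hRP` — `(𝔬 i).R U = ϱ • (id − Pp i U)`; `hT` — G′, (Dv, Dvstar), P are transposition
  pairs (p. 391).
INSIDE (no displayed trace): the member facts `Facts347` at rate `δG` and exponent `α := (δG − δ₃)∕(3δG)` and the row sum at margin `σ := (δG − δ₃)∕3` come from
✓`Prop7SectET3G0LayerFromThm310.lemma21Pack_geo9K` ∕ `B9GeoLemma21KLevelV1.rowSum261_geo9K` above an M-threshold (ZERO geometry hypotheses); the two letters are then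
`vDRDG_of_ids3152 ∕ vGDRD_of_ids3152` at constant `ϱ·(ℓ+1)·(BD + CP·(ℓ+1)·BG·c⁺)` and rate `δG − σ − 2αδG = δ₃`; the kept record is raised to the common constant
`B₄⋆ := max B₄ (ϱ·(ℓ+1)·(BD + CP·(ℓ+1)·BG·c⁺))` by `Letters313L2Pk.mono` (and `Letters313L2MZ` by the private constant-monotonicity below), `Letters313L2Pc.of_kept` re-assembles
the cut record, and the parent leaf is read at `B₄⋆` and the threshold `M₁⋆ := max M₁ (max M_facts M_row)` — its conclusion does not depend on either.
Conclusion `B9.Thm313Printed c35 geo9K bgT3 GG HasRWExp PosDefK` BYTE-IDENTICAL with the parent.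
NET DISPLAY CHANGE of the block-L² storey at T³: beyond `Letters313L2PZ`'s printed letters it now displays {(3.152) (already there), Thm 3.1 (3.42) for G′, (3.49) for P,
(3.46)₄ for G′, R = ϱ(I − P), three transposes} instead of {`vDRDG`, `vGDRD`} — every new row a NAMED printed line which Track A derives at the d = 4 pins (rows 18's
derived `h31 ∕ h49`, dag-n06-w7's closed (3.46)₄ `B9Eq346GradGpDivAtPinsL2Closed.blockBd_DvGcoSDvs_memberY_at`, def-Y's `rcoK_eq`, the `…AtPinsPhys` transposes).
NOT DONE BY DESIGN: the sup ∕ probe trio `Letters313Zc.gXH ∕ .wGp`, `hWE` (dag-n06-d g12: waits for the `bXH` class story) — `hletters : … Letters313Zc …`, `hLH3 : … Letters313HZc …`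
STAY as in the parent.
L-FLOOR (RULING g26-№20): none beyond the parent's.
HONEST SCOPE: bookkeeping over Track A's landed schemas and derivations; every analytic row stays a displayed HYPOTHESIS about the genuine operators (incl. the XL item
`Thm33G0` and `Letters313IMB`); N06(d = 3) NOT discharged; nothing here claims EX, the crux, V3∕R3, d = 4 or the mass gap; YM₃ on T³ = ladder rung R3 (RECORD), not the
Clay problem.

References: T. Bałaban, CMP **99** (1985) 389–434 [Balaban1985BackgroundPropagators] (Thm 3.13 p.426, (3.152)–(3.153) pp.425–426, Thm 3.1 (3.42)–(3.46) pp.397–398,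
(3.49) p.399, p.391); CMP **96** (1984) 223–250 [Balaban1984PropagatorsII] (Lemma 2.1 (2.59)–(2.61) pp.233–234, (2.51)–(2.56) pp.232–233).
-/

set_option autoImplicit false

noncomputable section

open scoped Matrix.Norms.L2Operator

namespace Summit.QuantumFields.YangMills.Theorems.Prop7SectET3N06LeavesRecordCutKept

open Literature.MathematicalPhysics.QuantumFieldTheory.Balaban1983to89
open Finset B6RandomWalk B6RandomWalkHom B9Thm34Ext B9Thm37GlueCor36 B11SectG B9SectDSup B9Thm37AllNorms
open B9Thm37AllNormsInstances B9FromB6 B9FromB6ModelSignsOn B9SectBStepWhole B9Thm312Whole B9Thm312WholeLeaf B9Thm312WholeLeft B9Thm313Whole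
open B9Thm313WholeLeft B9Thm312WholeLeafLeftGlob B9Ineq347CoReading B9SectCDiffDict B9CoRealizesRel B9Thm37Glue B9SectDL2Decay B9RWSums343Holder
open B9RWSumsReadsRel B9RWSumsReadsNbr B9Ineq347 B9Thm312WholeClasses B9Thm312WholeL2 B9Thm312WholeBlocksRel B9Thm312WholeBlocksNbr B9Thm313WholeLeafRel
open B9Thm312WholeHolder B9Thm312WholeHHolder B9Thm313WholeHolder B9Thm313WholeL2G B9Thm313WholeL2GP B9Thm313WholeInput B9Thm313WholeBlocksNbr B9Thm312WholeLeafAll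
open B9RWSums346SecondDiff B9Thm313WholeBlocksNbrRec B9RWSums344InputFam B9Thm312WholeDir B9Thm312WholeBlocksPairM B9Thm313WholeDir B9Thm313WholeDirInput B9Thm313WholeBlocksPairM
open B9Thm313WholeLeafCompletePairM B9Thm312WholeDirB B9Thm313WholeDirInputB B9Thm313WholeBlocksPairMB B9Thm313WholeLeafCompletePairMB B9Thm313WholeBlocksPairMZ B9Thm313WholeBlocksPairMBZ B9Thm313WholeLeafRelZ
open B9Thm312WholeHZ B9Thm313WholeZ B9Thm313WholeLeftZ B9Thm313WholeHolderZ B9Thm313WholeInputZ B9Thm313WholeDirZ B9Thm313WholeDirInputZ B9Thm313WholeDirInputBZ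
open B9Thm313WholeL2GZ B9Thm313WholeL2GPZ B9Thm313WholeDirL2Z B9Thm313WholeLeafCompletePairMBZ
open B9PerturbationMajorantAlgebra (Thm31GpMaj Proj349Maj)
open B9RWSums343to347Whole (Facts347)
open B9Thm313WholeRgdFrom3152 (Ids3152)
open B9Thm313WholeLettersCut (Letters313Zc Letters313HZc Letters313L2Pc)
open B9Thm313WholeLettersCutKept (Letters313L2Pk)
open B9Thm313WholeCutLettersL2From3152 (vDRDG_of_ids3152 vGDRD_of_ids3152)
open B6KLevelCensusIndexV1 (KIdx)
open B9GeoNormsKLevelV1 (geo9K)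
open B9GeoLemma21KLevelV1 (rowSum261_geo9K)
open B9CoRealizesRelAtLetters (RelB)
open Summit.QuantumFields.YangMills.Theorems.Prop7SectET3Members (hd3)
open Summit.QuantumFields.YangMills.Theorems.Prop7SectET3Geometry (geoOK_geo9K)
open Summit.QuantumFields.YangMills.Theorems.Prop7SectET3BgClass (bgT3)
open Summit.QuantumFields.YangMills.Theorems.Prop7SectET3N06LeavesRecordCut (t313_of_pins_T3_completePairMBZc)
open Summit.QuantumFields.YangMills.Theorems.Prop7SectET3G0LayerFromThm310 (lemma21Pack_geo9K)

variable {ℓ : ℕ} {hL : Odd (ℓ + 1) ∧ 1 < ℓ + 1} {b₀ b₁ : ℝ} {c35 : ℝ}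

/-- the direction-indexed block-L² letters `Letters313L2MZ` at a LARGER constant (`B₄ ≤ B₄'`; the weights `v_Z(y′)·L^{j′}η` are nonnegative) — the constant twin of
`B9Thm313WholeDirL2Z.letters313L2MZ_mono` (which moves the rate); private bookkeeping for meeting the derived letters' constant. [cite: Balaban1985BackgroundPropagators, (3.46) p.398 (bookkeeping)] -/
private theorem letters313L2MZ_mono_const {g : B9.Geometry} {B : B9.Backgrounds} {X Y Z W P : Type} [Fintype X] [Fintype Z] [Fintype W] [Fintype g.Site]
    {R₀ : ℝ} {H₀ : Prop} {𝔬 : Ops g B X Y Z W} {Dd Dds : B.Cfg → P → Module.End ℝ (X → ℝ)} {B₄ B₄' δ : ℝ} {U : B.Cfg}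
    (hG : GeoOK g) (hBB : B₄ ≤ B₄') {vZ : g.Site → ℝ} {hvZ : ∀ y, 0 < vZ y} (h : Letters313L2MZ 𝔬 Dd Dds R₀ H₀ B₄ δ vZ hvZ U) :
    Letters313L2MZ 𝔬 Dd Dds R₀ H₀ B₄' δ vZ hvZ U := by
  have hE : ∀ y y' : g.Site, 0 ≤ Real.exp (-(δ * g.dist y y')) := fun _ _ => Real.exp_nonneg _
  have hv : ∀ y : g.Site, 0 ≤ vZ y * g.len y := fun y => mul_nonneg (hvZ y).le (hG.lenle y)
  exact
    { dGDvd := fun ν => (h.dGDvd ν).mono fun y y' => mul_le_mul_of_nonneg_right hBB (hE y y')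
      dGQsd := fun ν => (h.dGQsd ν).mono fun y y' => mul_le_mul_of_nonneg_right (mul_le_mul_of_nonneg_right hBB (hv y')) (hE y y')
      rgdDd := fun μ => (h.rgdDd μ).mono fun y y' => mul_le_mul_of_nonneg_right hBB (hE y y') }

/-- ★★★ **THEOREM 3.13 AS THE WHOLE PRINTED LEAF, RE-CUT TO PRINT'S LETTER SPECIES, THE BLOCK-L² RECORD DISPLAYED BY ITS KEPT FIELDS** (statement of
✓`Prop7SectET3N06LeavesRecordCut.t313_of_pins_T3_completePairMBZc` — see there for every binder — with `hLL2` valued in dag-n06-d's kept sub-record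
`Letters313L2Pk … B₄ δ₃ ∧ Letters313L2MZ … B₄ δ₃` (NO `vDRDG ∕ vGDRD`), and the NEW displayed printed rows from which those two letters are DERIVED by
`B9Thm313WholeCutLettersL2From3152.vDRDG_of_ids3152 ∕ vGDRD_of_ids3152`: `h31` (Theorem 3.1 (3.42) for G′ at (BG, δG)), `h49` ((3.49) for `Pp` at (CP, δG)), `hDGD`
((3.46)₄ for G′ at (BD, δG)), `hRP` (R = ϱ•(I − P)), `hT` (the transposition pairs), the free data `Pp ϱ CP BD BG δG` with signs and ONE rate gap `hδ₃G : δ₃ < δG`; the identity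
(3.152) is the parent's displayed `h152`).  DISCHARGED INSIDE: the member facts and the row sum at `geo9K` above a threshold (`lemma21Pack_geo9K`, `rowSum261_geo9K`), the
constant of the derived letters (met by `Letters313L2Pk.mono` at `max B₄ (ϱ(ℓ+1)(BD + CP(ℓ+1)BG·c⁺))`), the re-assembly `Letters313L2Pc.of_kept`; then the parent BY NAME.
Conclusion: `B9.Thm313Printed c35 geo9K bgT3 GG HasRWExp PosDefK`, byte-identical.  Nothing of print asserted; NOT a discharge of N06(d = 3).
[cite: Balaban1985BackgroundPropagators, Thm 3.13 p.426, (3.152)-(3.153) pp.425-426, Thm 3.1 (3.42)+(3.46) pp.397-398, (3.49) p.399, p.391, Thm 3.12 p.423; Balaban1984PropagatorsII, (2.51)-(2.56) pp.232-233, Lemma 2.1 (2.59)-(2.61) pp.233-234] -/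
theorem t313_of_pins_T3_completePairMBZk [∀ i : KIdx 2 ℓ hd3 hL b₀ b₁, Fintype (geo9K i).Site] [∀ i : KIdx 2 ℓ hd3 hL b₀ b₁, DecidableEq (geo9K i).Site]
    {X Y Z W PX PY : KIdx 2 ℓ hd3 hL b₀ b₁ → Type} {P : Type} [∀ i, Fintype (X i)] [∀ i, DecidableEq (X i)] [∀ i, Fintype (Y i)]
    [∀ i, Fintype (Z i)] [∀ i, Fintype (W i)] [∀ i, Fintype (PX i)] [∀ i, Fintype (PY i)] [Fintype P]
    (𝔬 : ∀ i : KIdx 2 ℓ hd3 hL b₀ b₁, Ops (geo9K i) (bgT3 i) (X i) (Y i) (Z i) (W i)) (H₀ : KIdx 2 ℓ hd3 hL b₀ b₁ → Prop)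
    (GG : ∀ i : KIdx 2 ℓ hd3 hL b₀ b₁, B9.KernelFamily (geo9K i) (bgT3 i)) (bH : ∀ i : KIdx 2 ℓ hd3 hL b₀ b₁, BlockNorm (toB6 (geo9K i) 1 (H₀ i)) (W i → ℝ))
    (𝔭 : ∀ i : KIdx 2 ℓ hd3 hL b₀ b₁, HolderProbes (geo9K i) (bgT3 i) (X i) (Y i) (PX i) (PY i))
    (bHX : ∀ i : KIdx 2 ℓ hd3 hL b₀ b₁, ℝ → BlockNorm (toB6 (geo9K i) 1 (H₀ i)) (X i → ℝ))
    (Gp : ∀ i : KIdx 2 ℓ hd3 hL b₀ b₁, (bgT3 i).Cfg → Module.End ℝ (W i → ℝ))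
    (bXH : ∀ i : KIdx 2 ℓ hd3 hL b₀ b₁, BlockNorm (toB6 (geo9K i) 1 (H₀ i)) (X i → ℝ))
    (Pp : ∀ i : KIdx 2 ℓ hd3 hL b₀ b₁, (bgT3 i).Cfg → Module.End ℝ (W i → ℝ))
    (Dd Dds : ∀ i : KIdx 2 ℓ hd3 hL b₀ b₁, (bgT3 i).Cfg → P → Module.End ℝ (X i → ℝ))
    (bHW : ∀ i : KIdx 2 ℓ hd3 hL b₀ b₁, ℝ → BlockNorm (toB6 (geo9K i) 1 (H₀ i)) (W i → ℝ))
    (ev : ∀ i : KIdx 2 ℓ hd3 hL b₀ b₁, (geo9K i).Loc → X i → ℝ) (evY : ∀ i : KIdx 2 ℓ hd3 hL b₀ b₁, (geo9K i).Loc → Y i → ℝ)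
    (r Cev θ₁ θD θ₂ r₁ B₀ B₂ B₄ δ₀ δK σ ρ a₁ M₁ B₃ δ₃ ρ' α κ₀ : ℝ) (ϱ CP BD BG δG : ℝ) (Bh Bi Bq BhD Bx Bd θH θI θV Br : ℝ → ℝ)
    (Bi2 Bd2 : ℝ → ℝ → ℝ)
    (hθ₁ : 0 ≤ θ₁) (hθD : 0 ≤ θD) (hθH : ∀ β, 0 ≤ β → β < 1 → 0 ≤ θH β) (hθI : ∀ ε, 0 < ε → 0 ≤ θI ε) (hθ₂ : 0 ≤ θ₂)
    (hθV : ∀ ε, 0 < ε → 0 ≤ θV ε) (hr₁ : 0 ≤ r₁) (hB₀ : 0 ≤ B₀) (hB₂ : 0 ≤ B₂)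
    (hB₃ : 0 ≤ B₃) (hB₄ : 0 ≤ B₄) (hBr : ∀ ε, 0 < ε → 0 ≤ Br ε) (hσ : 0 < σ) (hρ' : 0 < ρ') (hρ'ρ : ρ' + 3 * σ ≤ ρ) (hρ'ρ₅ : ρ' + 5 * σ ≤ ρ)
    (hσρ' : 3 * σ < (1 - α) * ρ')
    (hρS : ρ ≤ δ₀) (hρ₃ : ρ ≤ δ₃) (hρδ : ρ + σ ≤ δK) (ha₁ : 0 < a₁) (hM₁ : 0 < M₁)
    (hα0 : 0 < α) (hα1 : α < 1) (hBi : ∀ ε, 0 < ε → ε ≤ 1 → 0 ≤ Bi ε) (hBd : ∀ ε, 0 < ε → ε ≤ 1 → 0 ≤ Bd ε)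
    (hBi2 : ∀ ε β, 0 < ε → ε ≤ 1 → 0 ≤ β → β < 1 → 0 ≤ Bi2 ε β) (hBd2 : ∀ ε β, 0 < ε → ε ≤ 1 → 0 ≤ β → β < 1 → 0 ≤ Bd2 ε β)
    (hBh : ∀ β, 0 ≤ β → β < 1 → 0 ≤ Bh β) (hBq : ∀ β, 0 ≤ β → β < 1 → 0 ≤ Bq β) (hBhD : ∀ β, 0 ≤ β → β < 1 → 0 ≤ BhD β)
    (hBx : ∀ β, 0 ≤ β → β < 1 → 0 ≤ Bx β) (hCev : 0 ≤ Cev)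
    (hϱ : 0 ≤ ϱ) (hCP : 0 ≤ CP) (hBD : 0 ≤ BD) (hBG : 0 ≤ BG) (hδ₃G : δ₃ < δG)
    (hκ : ∀ i : KIdx 2 ℓ hd3 hL b₀ b₁, (bH i).κ ≤ κ₀)
    (hκW : ∀ (i : KIdx 2 ℓ hd3 hL b₀ b₁) (ε : ℝ), (bHW i ε).κ ≤ κ₀)
    (hκX : ∀ i : KIdx 2 ℓ hd3 hL b₀ b₁, (bXH i).κ ≤ κ₀)
    (hcoR : ∀ (i : KIdx 2 ℓ hd3 hL b₀ b₁) (U : (bgT3 i).Cfg),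
      CoRealizesRel (GG i) 0 U (RelB i) (𝔬 i).blk (𝔬 i).blk (ev i) ((𝔬 i).GG U) ∧
      CoRealizesRel (GG i) 2 U (RelB i) (𝔬 i).blk (𝔬 i).blkY (evY i) ((𝔬 i).GG U ∘ₗ (𝔬 i).Dstar U))
    (hco1R : ∀ (i : KIdx 2 ℓ hd3 hL b₀ b₁) (U : (bgT3 i).Cfg), CoRealizesRel (GG i) 1 U (RelB i) (𝔬 i).blkY (𝔬 i).blk (ev i) ((𝔬 i).D U ∘ₗ (𝔬 i).GG U))
    (hcoG : ∀ (i : KIdx 2 ℓ hd3 hL b₀ b₁) (U : (bgT3 i).Cfg),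
      CoReadsGlob (GG i) 0 U (𝔬 i).blk (𝔬 i).blk (ev i) ((𝔬 i).GG U) ∧
      CoReadsGlob (GG i) 1 U (𝔬 i).blkY (𝔬 i).blk (ev i) ((𝔬 i).D U ∘ₗ (𝔬 i).GG U) ∧
      CoReadsGlob (GG i) 2 U (𝔬 i).blk (𝔬 i).blkY (evY i) ((𝔬 i).GG U ∘ₗ (𝔬 i).Dstar U))
    (hsymGG : ∀ i : KIdx 2 ℓ hd3 hL b₀ b₁, M₁ ≤ (geo9K i).M → ∀ α₀ : ℝ, 0 < α₀ → (geo9K i).M * α₀ ≤ a₁ →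
      ∀ U : (bgT3 i).Cfg, (bgT3 i).Reg335 c35 α₀ U → (bgT3 i).Reg336 c35 α₀ U →
        IsTransposePair ((𝔬 i).GG U) ((𝔬 i).GG U) ∧ IsTransposePair ((𝔬 i).D U ∘ₗ (𝔬 i).GG U) ((𝔬 i).GG U ∘ₗ (𝔬 i).Dstar U))
    (hl2N : ∀ (i : KIdx 2 ℓ hd3 hL b₀ b₁) (U : (bgT3 i).Cfg),
      L2ReadsNbr (R := (1 : ℝ)) (H := H₀ i) (GG i) 0 U (RelB i) r Cev (𝔬 i).blk (𝔬 i).blk (ev i) ((𝔬 i).GG U) ∧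
      L2ReadsNbr (R := (1 : ℝ)) (H := H₀ i) (GG i) 1 U (RelB i) r Cev (𝔬 i).blkY (𝔬 i).blk (ev i) ((𝔬 i).D U ∘ₗ (𝔬 i).GG U) ∧
      L2ReadsNbr (R := (1 : ℝ)) (H := H₀ i) (GG i) 2 U (RelB i) r Cev (𝔬 i).blk (𝔬 i).blkY (evY i) ((𝔬 i).GG U ∘ₗ (𝔬 i).Dstar U) ∧
      L2ReadsNbr (R := (1 : ℝ)) (H := H₀ i) (GG i) 3 U (RelB i) r Cev ((𝔬 i).blk ∘ Prod.fst) (𝔬 i).blk (ev i)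
        (familyOp (fun q : P × P => Dd i U q.1 ∘ₗ ((𝔬 i).GG U ∘ₗ Dds i U q.2))) ∧
      L2ReadsNbr (R := (1 : ℝ)) (H := H₀ i) (GG i) 4 U (RelB i) r Cev ((𝔬 i).blk ∘ Prod.fst) (𝔬 i).blk (ev i)
        (familyOp (fun q : P × P => (Dd i U q.1 ∘ₗ Dd i U q.2) ∘ₗ (𝔬 i).GG U)) ∧
      L2ReadsNbr (R := (1 : ℝ)) (H := H₀ i) (GG i) 5 U (RelB i) r Cev ((𝔬 i).blk ∘ Prod.fst) (𝔬 i).blk (ev i)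
        (familyOp (fun q : P × P => (𝔬 i).GG U ∘ₗ (Dds i U q.1 ∘ₗ Dds i U q.2))))
    (hH1N : ∀ (i : KIdx 2 ℓ hd3 hL b₀ b₁) (U : (bgT3 i).Cfg),
      H1ReadsNbr (GG i) U (𝔭 i) (RelB i) r (𝔬 i).blk (𝔬 i).blkY (ev i) (evY i) ((𝔬 i).D U ∘ₗ (𝔬 i).GG U)
        ((𝔬 i).GG U ∘ₗ (𝔬 i).Dstar U))
    (hIF : ∀ (i : KIdx 2 ℓ hd3 hL b₀ b₁) (U : (bgT3 i).Cfg),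
      InputReadsFam (GG i) U (bHX i) r ((𝔬 i).blk ∘ Prod.fst) ((𝔭 i).blkPX ∘ Prod.fst) (fun β => sliceProbe ((𝔭 i).ΦX U β)) (ev i)
        (familyOp (fun q : P × P => Dd i U q.1 ∘ₗ ((𝔬 i).GG U ∘ₗ Dds i U q.2))))
    (hmodel : ∀ i : KIdx 2 ℓ hd3 hL b₀ b₁, M₁ ≤ (geo9K i).M → ∀ α₀ : ℝ, 0 < α₀ → (geo9K i).M * α₀ ≤ a₁ →
      ∀ U : (bgT3 i).Cfg, (bgT3 i).Reg335 c35 α₀ U → (bgT3 i).Reg336 c35 α₀ U →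
        Thm33G0 (𝔬 i) 1 (H₀ i) B₀ δ₀ U ∧
        Step (𝔬 i) 1 (H₀ i) (geoOK_geo9K i).lenle 1 (θ₁ * ((geo9K i).M * α₀)) δK U ∧
        Step (𝔬 i) 1 (H₀ i) (geoOK_geo9K i).lenle 2 (θ₁ * ((geo9K i).M * α₀)) δK U ∧
        FormSmall (𝔬 i) (r₁ * ((geo9K i).M * α₀)) U ∧ Identities (𝔬 i) U)
    (hleft : ∀ i : KIdx 2 ℓ hd3 hL b₀ b₁, M₁ ≤ (geo9K i).M → ∀ α₀ : ℝ, 0 < α₀ → (geo9K i).M * α₀ ≤ a₁ →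
      ∀ U : (bgT3 i).Cfg, (bgT3 i).Reg335 c35 α₀ U → (bgT3 i).Reg336 c35 α₀ U →
        LeftStep (𝔬 i) 1 (H₀ i) (geoOK_geo9K i).lenle B₀ δ₀ (θD * ((geo9K i).M * α₀)) δK U)
    (wZ : ∀ i : KIdx 2 ℓ hd3 hL b₀ b₁, (geo9K i).Site → ℝ) (hwZ : ∀ i y, 0 < wZ i y)
    (hletters : ∀ i : KIdx 2 ℓ hd3 hL b₀ b₁, M₁ ≤ (geo9K i).M → ∀ α₀ : ℝ, 0 < α₀ → (geo9K i).M * α₀ ≤ a₁ →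
      ∀ U : (bgT3 i).Cfg, (bgT3 i).Reg335 c35 α₀ U → (bgT3 i).Reg336 c35 α₀ U →
        Letters313Zc (𝔬 i) (Gp i) 1 (H₀ i) (geoOK_geo9K i) (wZ i) (hwZ i) B₃ δ₃ (bXH i) U)
    (h152 : ∀ i : KIdx 2 ℓ hd3 hL b₀ b₁, M₁ ≤ (geo9K i).M → ∀ α₀ : ℝ, 0 < α₀ → (geo9K i).M * α₀ ≤ a₁ →
      ∀ U : (bgT3 i).Cfg, (bgT3 i).Reg335 c35 α₀ U → (bgT3 i).Reg336 c35 α₀ U → Ids3152 (𝔬 i) (Gp i) U)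
    -- ======== NEW: Theorem 3.1 for G′, (3.49) for P, (3.46)₄ for G′, R = ϱ(I − P), the transposes (the inputs of `vDRDG_of_ids3152 ∕ vGDRD_of_ids3152`) ========
    (h31 : ∀ i : KIdx 2 ℓ hd3 hL b₀ b₁, M₁ ≤ (geo9K i).M → ∀ α₀ : ℝ, 0 < α₀ → (geo9K i).M * α₀ ≤ a₁ →
      ∀ U : (bgT3 i).Cfg, (bgT3 i).Reg335 c35 α₀ U → (bgT3 i).Reg336 c35 α₀ U →
        Thm31GpMaj (𝔬 i).blkW (𝔬 i).blk (Gp i U) ((𝔬 i).Dv U) ((𝔬 i).Dvstar U) 1 (H₀ i) BG δG)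
    (h49 : ∀ i : KIdx 2 ℓ hd3 hL b₀ b₁, M₁ ≤ (geo9K i).M → ∀ α₀ : ℝ, 0 < α₀ → (geo9K i).M * α₀ ≤ a₁ →
      ∀ U : (bgT3 i).Cfg, (bgT3 i).Reg335 c35 α₀ U → (bgT3 i).Reg336 c35 α₀ U →
        Proj349Maj (𝔬 i).blkW (𝔬 i).blk (Pp i U) ((𝔬 i).Dv U) ((𝔬 i).Dvstar U) 1 (H₀ i) CP δG)
    (hDGD : ∀ i : KIdx 2 ℓ hd3 hL b₀ b₁, M₁ ≤ (geo9K i).M → ∀ α₀ : ℝ, 0 < α₀ → (geo9K i).M * α₀ ≤ a₁ →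
      ∀ U : (bgT3 i).Cfg, (bgT3 i).Reg335 c35 α₀ U → (bgT3 i).Reg336 c35 α₀ U →
        BlockBd (g := toB6 (geo9K i) 1 (H₀ i)) (𝔬 i).blk (𝔬 i).blk ((𝔬 i).Dv U ∘ₗ Gp i U ∘ₗ (𝔬 i).Dvstar U)
          (fun (y y' : (geo9K i).Site) => BD * Real.exp (-(δG * (geo9K i).dist y y'))))
    (hRP : ∀ i : KIdx 2 ℓ hd3 hL b₀ b₁, M₁ ≤ (geo9K i).M → ∀ α₀ : ℝ, 0 < α₀ → (geo9K i).M * α₀ ≤ a₁ →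
      ∀ U : (bgT3 i).Cfg, (bgT3 i).Reg335 c35 α₀ U → (bgT3 i).Reg336 c35 α₀ U → (𝔬 i).R U = ϱ • (LinearMap.id - Pp i U))
    (hT : ∀ i : KIdx 2 ℓ hd3 hL b₀ b₁, M₁ ≤ (geo9K i).M → ∀ α₀ : ℝ, 0 < α₀ → (geo9K i).M * α₀ ≤ a₁ →
      ∀ U : (bgT3 i).Cfg, (bgT3 i).Reg335 c35 α₀ U → (bgT3 i).Reg336 c35 α₀ U →
        IsTransposePair (Gp i U) (Gp i U) ∧ IsTransposePair ((𝔬 i).Dv U) ((𝔬 i).Dvstar U) ∧ IsTransposePair (Pp i U) (Pp i U))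
    -- ======== the parent's remaining rows, VERBATIM ========
    (hlettersD : ∀ i : KIdx 2 ℓ hd3 hL b₀ b₁, M₁ ≤ (geo9K i).M → ∀ α₀ : ℝ, 0 < α₀ → (geo9K i).M * α₀ ≤ a₁ →
      ∀ U : (bgT3 i).Cfg, (bgT3 i).Reg335 c35 α₀ U → (bgT3 i).Reg336 c35 α₀ U →
        Letters313DZ (𝔬 i) 1 (H₀ i) (geoOK_geo9K i) (wZ i) (hwZ i) B₃ δ₃ (bH i) U ∧
          Letters313DMZ (𝔬 i) (𝔭 i) (Dd i) 1 (H₀ i) (geoOK_geo9K i) (wZ i) (hwZ i) B₃ Bq δ₃ (bH i) U)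
    (hG0C : ∀ i : KIdx 2 ℓ hd3 hL b₀ b₁, M₁ ≤ (geo9K i).M → ∀ α₀ : ℝ, 0 < α₀ → (geo9K i).M * α₀ ≤ a₁ →
      ∀ U : (bgT3 i).Cfg, (bgT3 i).Reg335 c35 α₀ U → (bgT3 i).Reg336 c35 α₀ U →
        Thm33G0Dir (𝔬 i) (𝔭 i) (Dd i) (Dds i) 1 (H₀ i) (bHX i) B₀ Bh Bi Bi2 δ₀ U ∧
          Thm33G0DirR (𝔬 i) (Dds i) 1 (H₀ i) B₀ δ₀ U)
    (hstepD : ∀ i : KIdx 2 ℓ hd3 hL b₀ b₁, M₁ ≤ (geo9K i).M → ∀ α₀ : ℝ, 0 < α₀ → (geo9K i).M * α₀ ≤ a₁ →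
      ∀ U : (bgT3 i).Cfg, (bgT3 i).Reg335 c35 α₀ U → (bgT3 i).Reg336 c35 α₀ U →
        StepDirB (𝔬 i) (𝔭 i) (Dd i) (Dds i) 1 (H₀ i) (bHX i) (geoOK_geo9K i).lenle (θD * ((geo9K i).M * α₀))
          (fun β => θH β * ((geo9K i).M * α₀)) (fun ε => θI ε * ((geo9K i).M * α₀)) δK U)
    (hLHH : ∀ i : KIdx 2 ℓ hd3 hL b₀ b₁, M₁ ≤ (geo9K i).M → ∀ α₀ : ℝ, 0 < α₀ → (geo9K i).M * α₀ ≤ a₁ →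
      ∀ U : (bgT3 i).Cfg, (bgT3 i).Reg335 c35 α₀ U → (bgT3 i).Reg336 c35 α₀ U →
        LettersHHZ (𝔬 i) (𝔭 i) 1 (H₀ i) (geoOK_geo9K i).lenle
          (weightNorm (BlockNorm.ofBlocks (toB6 (geo9K i) 1 (H₀ i)) (𝔬 i).blkZ) (wZ i) fun y => (hwZ i y).le) Bq δ₃ U)
    (hLH3 : ∀ i : KIdx 2 ℓ hd3 hL b₀ b₁, M₁ ≤ (geo9K i).M → ∀ α₀ : ℝ, 0 < α₀ → (geo9K i).M * α₀ ≤ a₁ →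
      ∀ U : (bgT3 i).Cfg, (bgT3 i).Reg335 c35 α₀ U → (bgT3 i).Reg336 c35 α₀ U →
        Letters313HZc (𝔬 i) (𝔭 i) (Gp i) 1 (H₀ i) (geoOK_geo9K i) (wZ i) (hwZ i) (bH i) BhD Bx δ₃ (bXH i) U)
    (hG0L2 : ∀ i : KIdx 2 ℓ hd3 hL b₀ b₁, M₁ ≤ (geo9K i).M → ∀ α₀ : ℝ, 0 < α₀ → (geo9K i).M * α₀ ≤ a₁ →
      ∀ U : (bgT3 i).Cfg, (bgT3 i).Reg335 c35 α₀ U → (bgT3 i).Reg336 c35 α₀ U →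
        Thm33G0L2M (𝔬 i) (Dd i) (Dds i) 1 (H₀ i) B₂ δ₀ U)
    (hstepL2 : ∀ i : KIdx 2 ℓ hd3 hL b₀ b₁, M₁ ≤ (geo9K i).M → ∀ α₀ : ℝ, 0 < α₀ → (geo9K i).M * α₀ ≤ a₁ →
      ∀ U : (bgT3 i).Cfg, (bgT3 i).Reg335 c35 α₀ U → (bgT3 i).Reg336 c35 α₀ U →
        StepL2 (𝔬 i) 1 (H₀ i) (θ₂ * ((geo9K i).M * α₀)) δK U)
    (vZ : ∀ i : KIdx 2 ℓ hd3 hL b₀ b₁, (geo9K i).Site → ℝ) (hvZ : ∀ i y, 0 < vZ i y)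
    -- ======== RE-CUT: the block-L² record by its KEPT fields ========
    (hLL2 : ∀ i : KIdx 2 ℓ hd3 hL b₀ b₁, M₁ ≤ (geo9K i).M → ∀ α₀ : ℝ, 0 < α₀ → (geo9K i).M * α₀ ≤ a₁ →
      ∀ U : (bgT3 i).Cfg, (bgT3 i).Reg335 c35 α₀ U → (bgT3 i).Reg336 c35 α₀ U →
        Letters313L2Pk (𝔬 i) (Dd i) (Dds i) 1 (H₀ i) B₄ δ₃ (vZ i) (hvZ i) U ∧
          Letters313L2MZ (𝔬 i) (Dd i) (Dds i) 1 (H₀ i) B₄ δ₃ (vZ i) (hvZ i) U)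
    (hLIM : ∀ i : KIdx 2 ℓ hd3 hL b₀ b₁, M₁ ≤ (geo9K i).M → ∀ α₀ : ℝ, 0 < α₀ → (geo9K i).M * α₀ ≤ a₁ →
      ∀ U : (bgT3 i).Cfg, (bgT3 i).Reg335 c35 α₀ U → (bgT3 i).Reg336 c35 α₀ U →
        Letters313IMB (𝔬 i) (𝔭 i) (Dd i) (Dds i) 1 (H₀ i) (geoOK_geo9K i).lenle (bHX i) (bHW i) Br (fun ε => θV ε * ((geo9K i).M * α₀))
          Bd Bd2 δ₃ δK U)
    (HasRWExp : ∀ i : KIdx 2 ℓ hd3 hL b₀ b₁, B9.KernelFamily (geo9K i) (bgT3 i) → (bgT3 i).Cfg → ℝ → Prop)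
    (PosDefK : ∀ i : KIdx 2 ℓ hd3 hL b₀ b₁, B9.KernelFamily (geo9K i) (bgT3 i) → (bgT3 i).Cfg → Prop)
    (hpinE : ∀ i : KIdx 2 ℓ hd3 hL b₀ b₁, HasRWExp i = HasRWExpOfOps (𝔬 i)) (hpinK : ∀ i : KIdx 2 ℓ hd3 hL b₀ b₁, PosDefK i = PosDefKOfOps (𝔬 i)) :
    B9.Thm313Printed c35 geo9K bgT3 GG HasRWExp PosDefK := by
  classical
  -- the letters' rate is positive (ρ′ > 0, ρ′ + 3σ ≤ ρ ≤ δ₃) and strictly below the G′-material's rate δG: room for two (2.60) shifts and one margin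
  have hδ₃pos : 0 < δ₃ := by linarith
  have hδGpos : 0 < δG := hδ₃pos.trans hδ₃G
  obtain ⟨τ, hτdef⟩ : ∃ τ : ℝ, τ = (δG - δ₃) / 3 := ⟨_, rfl⟩
  have hτpos : 0 < τ := by rw [hτdef]; exact div_pos (by linarith) (by norm_num)
  have hτ3 : 3 * τ = δG - δ₃ := by rw [hτdef]; ring
  obtain ⟨αf, hαfdef⟩ : ∃ αf : ℝ, αf = τ / δG := ⟨_, rfl⟩
  have hαfpos : 0 < αf := by rw [hαfdef]; exact div_pos hτpos hδGpos
  have hαfδ : αf * δG = τ := by rw [hαfdef]; exact div_mul_cancel₀ τ hδGpos.ne'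
  have hαf2 : αf < 1 / 2 := by
    rw [hαfdef, div_lt_iff₀ hδGpos]
    linarith
  -- the member facts at (δG, αf) and the row sum at margin τ, above one M-threshold (no geometry hypotheses)
  obtain ⟨Mth, -, -, hfacts⟩ :=
    lemma21Pack_geo9K (ℓ := ℓ) (hL := hL) (b₀ := b₀) (b₁ := b₁) H₀ (αF := 1 / 2) hαfpos hαf2 hδGpos (by norm_num) (by norm_num)
  obtain ⟨ML, c, hrow⟩ := rowSum261_geo9K (d := 2) (ℓ := ℓ) (hd := hd3) (hL := hL) (b₀ := b₀) (b₁ := b₁) τ hτpos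
  have hrow' : ∀ i : KIdx 2 ℓ hd3 hL b₀ b₁, ML ≤ (geo9K i).M → RowSum (toB6 (geo9K i) 1 (H₀ i)) τ (max c 0) :=
    fun i hM y => (hrow i hM y).trans (le_max_left _ _)
  have hc' : (0 : ℝ) ≤ max c 0 := le_max_right _ _
  -- the common constant of the re-assembled block-L² record and the common threshold
  obtain ⟨B₄s, hB₄sdef⟩ : ∃ B₄s : ℝ, B₄s = max B₄ (ϱ * ((ℓ + 1 : ℕ) : ℝ) * (BD + CP * ((ℓ + 1 : ℕ) : ℝ) * BG * max c 0)) := ⟨_, rfl⟩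
  have hB₄le : B₄ ≤ B₄s := by rw [hB₄sdef]; exact le_max_left _ _
  have hBder : ϱ * ((ℓ + 1 : ℕ) : ℝ) * (BD + CP * ((ℓ + 1 : ℕ) : ℝ) * BG * max c 0) ≤ B₄s := by rw [hB₄sdef]; exact le_max_right _ _
  have hB₄s0 : 0 ≤ B₄s := hB₄.trans hB₄le
  obtain ⟨M₁s, hM₁sdef⟩ : ∃ M₁s : ℝ, M₁s = max M₁ (max Mth ML) := ⟨_, rfl⟩
  have hM₁le : M₁ ≤ M₁s := by rw [hM₁sdef]; exact le_max_left _ _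
  have hMth : Mth ≤ M₁s := by rw [hM₁sdef]; exact (le_max_left _ _).trans (le_max_right _ _)
  have hML : ML ≤ M₁s := by rw [hM₁sdef]; exact (le_max_right _ _).trans (le_max_right _ _)
  have hM₁s : 0 < M₁s := lt_of_lt_of_le hM₁ hM₁le
  -- the budget rows of `vDRDG_of_ids3152 ∕ vGDRD_of_ids3152` at (δ, α, σ) := (δG, αf, τ): δG − τ − αf·δG = δ₃ + τ, δG − τ − 2αf·δG = δ₃
  have hαδ : 0 ≤ αf * δG := by rw [hαfδ]; exact hτpos.le
  have hbud : 0 ≤ δG - τ - αf * δG := by rw [hαfδ]; linarith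
  have hδD : δG - τ - αf * δG ≤ δG := by rw [hαfδ]; linarith
  have hδ₄ : δ₃ ≤ δG - τ - 2 * (αf * δG) := by rw [hαfδ]; linarith
  -- the cut block-L² record RE-ASSEMBLED above the threshold: kept fields raised to `B₄s`, the two letters DERIVED at (B₄s, δ₃)
  have hLL2c : ∀ i : KIdx 2 ℓ hd3 hL b₀ b₁, M₁s ≤ (geo9K i).M → ∀ α₀ : ℝ, 0 < α₀ → (geo9K i).M * α₀ ≤ a₁ →
      ∀ U : (bgT3 i).Cfg, (bgT3 i).Reg335 c35 α₀ U → (bgT3 i).Reg336 c35 α₀ U →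
        Letters313L2Pc (𝔬 i) (Dd i) (Dds i) 1 (H₀ i) B₄s δ₃ (vZ i) (hvZ i) U ∧
          Letters313L2MZ (𝔬 i) (Dd i) (Dds i) 1 (H₀ i) B₄s δ₃ (vZ i) (hvZ i) U := by
    intro i hM α₀ hα₀ hMa U hU hU'
    have hMi : M₁ ≤ (geo9K i).M := hM₁le.trans hM
    obtain ⟨hk, hm⟩ := hLL2 i hMi α₀ hα₀ hMa U hU hU'
    obtain ⟨hGpT, hDvT, hPT⟩ := hT i hMi α₀ hα₀ hMa U hU hU'
    have hF := hfacts i (hMth.trans hM)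
    have hR := hrow' i (hML.trans hM)
    refine ⟨B9Thm313WholeLettersCutKept.Letters313L2Pc.of_kept (hk.mono (geoOK_geo9K i) hB₄ hB₄le le_rfl) ?_ ?_, letters313L2MZ_mono_const (geoOK_geo9K i) hB₄le hm⟩
    · exact vDRDG_of_ids3152 (geoOK_geo9K i) hF hR (h31 i hMi α₀ hα₀ hMa U hU hU') (h49 i hMi α₀ hα₀ hMa U hU hU')
        (hDGD i hMi α₀ hα₀ hMa U hU hU') (hRP i hMi α₀ hα₀ hMa U hU hU') (h152 i hMi α₀ hα₀ hMa U hU hU') hGpT hDvT hPT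
        hϱ hBG hCP hBD hc' hτpos.le hαδ le_rfl le_rfl hbud hδD hBder hδ₄
    · exact vGDRD_of_ids3152 (geoOK_geo9K i) hF hR (h31 i hMi α₀ hα₀ hMa U hU hU') (h49 i hMi α₀ hα₀ hMa U hU hU')
        (hDGD i hMi α₀ hα₀ hMa U hU hU') (hRP i hMi α₀ hα₀ hMa U hU hU') (h152 i hMi α₀ hα₀ hMa U hU hU') hGpT hDvT hPT
        hϱ hBG hCP hBD hc' hτpos.le hαδ le_rfl le_rfl hbud hδD hBder hδ₄
  -- the parent leaf BY NAME at (B₄s, M₁s); every displayed row above M₁ restricts to M₁s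
  exact t313_of_pins_T3_completePairMBZc 𝔬 H₀ GG bH 𝔭 bHX Gp bXH Dd Dds bHW ev evY
    r Cev θ₁ θD θ₂ r₁ B₀ B₂ B₄s δ₀ δK σ ρ a₁ M₁s B₃ δ₃ ρ' α κ₀ Bh Bi Bq BhD Bx Bd θH θI θV Br Bi2 Bd2
    hθ₁ hθD hθH hθI hθ₂ hθV hr₁ hB₀ hB₂ hB₃ hB₄s0 hBr hσ hρ' hρ'ρ hρ'ρ₅ hσρ' hρS hρ₃ hρδ ha₁ hM₁s hα0 hα1 hBi hBd hBi2 hBd2 hBh hBq hBhD hBx hCev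
    hκ hκW hκX hcoR hco1R hcoG (fun i hM => hsymGG i (hM₁le.trans hM)) hl2N hH1N hIF
    (fun i hM => hmodel i (hM₁le.trans hM)) (fun i hM => hleft i (hM₁le.trans hM)) wZ hwZ
    (fun i hM => hletters i (hM₁le.trans hM)) (fun i hM => h152 i (hM₁le.trans hM)) (fun i hM => hlettersD i (hM₁le.trans hM))
    (fun i hM => hG0C i (hM₁le.trans hM)) (fun i hM => hstepD i (hM₁le.trans hM)) (fun i hM => hLHH i (hM₁le.trans hM))
    (fun i hM => hLH3 i (hM₁le.trans hM)) (fun i hM => hG0L2 i (hM₁le.trans hM)) (fun i hM => hstepL2 i (hM₁le.trans hM)) vZ hvZ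
    hLL2c (fun i hM => hLIM i (hM₁le.trans hM)) HasRWExp PosDefK hpinE hpinK

end Summit.QuantumFields.YangMills.Theorems.Prop7SectET3N06LeavesRecordCutKept

end
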